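import Summits.NavierStokesRegularity.NavierStokesRegularity.Theorems.StableStrataDoorOneSliceSeqDoor
import Literature.Analysis.FluidPDE.PineauVicolOneSliceReductionK2
import Literature.Analysis.FluidPDE.TaoCarlemanLocal

/-!
# PeepholeVorticityDoorDefs — door S29 «PeepholeVorticityDoor»: texts, explicit constants, composition (nsreg-p1 g23 ROUND-27,
# `r27/Sketch29.lean` 18df910412472115 §0–§2b + §4; theorems-only landing FILE 1 of the LINE DOC by nsreg-p6 g15, DIRECTOR-NS #106)

THE DOOR (door frame of S23–S27, class-uniform ONE-TIME form, EFFECTIVE): for every viscosity `ν`, Type-I constant `M` and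
peephole `U = B_r(y₀)` (any centre, any radius, in similarity coordinates) there is `ε = ε(ν, M, U) > 0`, and for every
class `(T, ρ, E₀)` a lateness threshold `t⋆ < T`, such that: a classical Leray–Hopf solution with local Type I(`M`) on
`Q_ρ(x₀, T)` whose SCALE-NORMALISED VORTICITY `(T − t̄) ω(t̄, x₀ + √(T−t̄)·)` is `≤ ε` on `U` at ONE time `t̄ ∈ (t⋆, T)` is
regular at `(x₀, T)` («Type-I singularities have no vorticity holes»).

MECHANISM (no compactness, no stratum, no Liouville theorem — NOT an instance of the S26 schema): quantitative SPACE-LIKE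
UNIQUE CONTINUATION for the vorticity equation `∂ₜω − Δω = ω·∇u − u·∇ω` under the Type-I coefficient bounds
(`|u| ≤ C`, `|∇u| ≤ K` one similarity unit below the apex): ONE application of Tao 2021 Prop. 4.3 — tree
`TaoCarleman.second_carleman_inequality_of_ball` (PROVED) — to the time-reversed vorticity on a cylinder hanging below the
slice `t̄` and centred at the peephole carries `ε`-smallness on the peephole to `θ(M)`-smallness of the scale-invariant
enstrophy on the CENTRAL ball `B(x₀, 2R√(T−t'))` at a slightly earlier time `t'` (Gaussian-weight loss
`exp(O(K(M)(|y₀|+R)²))`, explicit); then Pineau–Vicol Lemma 9.4 (tree `pineauVicol_smallVorticity_propagation`, PROVED) traps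
the small enstrophy up to `T`, and Prop. 9.5 + CKN (tree `pineauVicol_regular_of_zoom`) give regularity.  `ε` is a NUMBER:
`ε ≈ θ_PV(M) · exp(−C·K(M)·(|y₀|+R(M))²·log((|y₀|+R(M))/r))`.

* §0 the observable; §1 the door texts `TargetPeepholeVorticityAt ν M U`, `TargetPeepholeVorticity`;
* §2 the Pineau–Vicol-frame texts: `PeepholeToCore` (hB′ — its far-Whitney-ball case is Barker–Prange CMP 2021 Prop. 2 Step 1 /
  Tao 2021 (5.7) [nsreg-lit §R127: INSTANCE]; new as typed: any radius, any centre, pointwise local Type I — peephole smallness at `t̄` ⇒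
  small core enstrophy at some `t' ∈ [(1+2τ)t̄, (1+τ)t̄]`) and `PVPeepholeRegularity` (Thm 1.9 with (1.17) replaced by the
  peephole hypothesis);
* §3 (this landing: the three stubs as HYPOTHESES of `targetPeepholeVorticity_of`; registered-stub skeleton in the sketch): `stub_peepholeToCore` (Tao Prop 4.3, the new content), `stub_assembly` (bookkeeping twin of
  tree `pineauVicol2026_oneSlice_regularity_of_core'`: hB′ then Lemma 9.4 at `t'`, (9.15)–(9.16), Prop 9.5), `stub_frame`
  (door frame ↦ PV frame: `ν`-rescaling, translation, Leray–Hopf pressure ⇒ (1.16), bounded cylinder ⇒ `IsBackwardBoundedAt`),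
  and the composition `targetPeepholeVorticity_of_stubs` (kernel-checked).

WHAT THIS IS NOT: not NS regularity (Clay (A)), not a dent in `NoTypeII` (stmt-0056) — an effective one-time criterion
INSIDE the Type-I class; no claim on 10661 / 16274 / 1217.
-/

noncomputable section

set_option linter.dupNamespace false

namespace Summit.NavierStokesRegularity.NavierStokesRegularity.Theorems.PeepholeVorticityDoor

open MeasureTheory Set Function Filter Topology TopologicalSpace Metric
open scoped RealInnerProductSpace NNReal ENNReal Topology
open Literature.Analysis Literature.Analysis.FluidPDE
open Summit.NavierStokesRegularity.NavierStokesRegularity.Theorems.PoloidalWindowDoorPoloidalWindowRigidityWindow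
open Summit.NavierStokesRegularity.NavierStokesRegularity.Theorems.ZoomReturnDoorDefs
open Summit.NavierStokesRegularity.NavierStokesRegularity.Theorems.StableStrataDoorDefs
open Summit.NavierStokesRegularity.NavierStokesRegularity.Theorems.StableStrataDoorSchema
open Summit.NavierStokesRegularity.NavierStokesRegularity.Theorems.StableStrataDoorOneSliceDefs
open Summit.NavierStokesRegularity.NavierStokesRegularity.Theorems.StableStrataDoorOneSliceSeqDoor

/-! ## §0 The observable -/

/-- **scale-normalised peephole vorticity** of a window field `F` on the peephole `U`: `sup_{y ∈ U} ‖curl F y‖` as an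
extended real.  For the physical window field `F = √(T−t) · u(t, x₀ + √(T−t)·)` one has
`curl F y = (T − t) ω(t, x₀ + √(T−t) y)`, the scale-invariant vorticity. -/
def peepholeVorticity (U : Set (EuclideanSpace ℝ (Fin 3)))
    (F : EuclideanSpace ℝ (Fin 3) → EuclideanSpace ℝ (Fin 3)) : ℝ≥0∞ :=
  ⨆ y ∈ U, ‖curl F y‖ₑ

/-! ## §1 The door texts (door frame of S23–S27; class-uniform one-time form) -/

/-- **door S29 at `(ν, M, U)`:** some `ε > 0` such that for every class `(T, ρ, E₀)` there is ONE lateness threshold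
`t⋆ < T` serving every classical Leray–Hopf solution with life span `T`, initial kinetic energy `≤ E₀` and local Type I(`M`)
on `Q_ρ(x₀, T)`: scale-normalised vorticity `≤ ε` on the peephole `U` at ONE time `t̄ ∈ (t⋆, T)` excludes the singularity
at `(x₀, T)`.  (Shape = `UniformOneTimeDoorAt (peepholeVorticity U) ν M` of `r27/OneTimeSchema.lean`.) -/
def TargetPeepholeVorticityAt (ν M : ℝ) (U : Set (EuclideanSpace ℝ (Fin 3))) : Prop :=
  ∃ ε : ℝ, 0 < ε ∧ ∀ (T ρ E₀ : ℝ), 0 < T → 0 < ρ → ∃ tstar : ℝ, tstar < T ∧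
    ∀ (u : ℝ → EuclideanSpace ℝ (Fin 3) → EuclideanSpace ℝ (Fin 3)) (p : ℝ → EuclideanSpace ℝ (Fin 3) → ℝ),
    IsClassicalNSSolutionOn (Set.Ico 0 T) ν 0 u p → IsLerayHopfOn T ν 0 (u 0) u → HasRapidSpatialDecay (u 0) →
    VectorCalculus.kineticEnergy (u 0) ≤ E₀ →
    ∀ (x₀ : EuclideanSpace ℝ (Fin 3)),
    (∀ t ∈ Set.Ico 0 T, T - ρ ^ 2 < t → ∀ x ∈ Metric.ball x₀ ρ, ‖u t x‖ * (‖x - x₀‖ + Real.sqrt (ν * (T - t))) ≤ M) →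
    ∀ tb ∈ Set.Ioo tstar T, (∀ y ∈ U, ‖curl (physWindowField T x₀ u tb) y‖ ≤ ε) → IsBackwardBoundedAt u T x₀

/-- **door S29:** every viscosity, every Type-I constant, every ball peephole. -/
def TargetPeepholeVorticity : Prop :=
  ∀ (ν : ℝ), 0 < ν → ∀ (M : ℝ) (y₀ : EuclideanSpace ℝ (Fin 3)) (r : ℝ), 0 < r →
    TargetPeepholeVorticityAt ν M (Metric.ball y₀ r)

/-! ## §2 The Pineau–Vicol-frame texts (`ν = 1`, region `[−1,0) × B₁`, apex `(0,0)`) -/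

/-- **hB′ · PEEPHOLE-TO-CORE TRANSFER** (the Whitney-ball case `|y₀| ≫ 1`, `r = |y₀|/2` under global bounds is Barker–Prange CMP
2021 Prop. 2 Step 1 / Tao 2021 (5.7); typed here at any radius and centre under pointwise local Type I).  For the Type-I constant `C_u`, a target
`θ > 0`, a core radius `R ≥ 2`, gradient constants `K, K₂` and the peephole `(y₀, r)` there are `ε > 0` and a lag `τ > 0`, and
for every gradient scale `c₁ > 0` a lateness `T₁ ∈ (0, 1]`, such that: for a classical solution on `[−1,0) × B₁` with the
Type-I bound (1.15) and the gradient bounds of orders `1, 2` at scales `|x| + √(−t) ≤ c₁`, if at ONE `t̄ ∈ (−T₁, 0)` the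
scale-normalised vorticity is `ε`-small on the peephole, `(−t̄)‖ω(t̄, x)‖ ≤ ε` for `x ∈ B(√(−t̄) y₀, √(−t̄) r)`, then at SOME
slightly earlier time `t' ∈ [(1+2τ)t̄, (1+τ)t̄]` the core enstrophy is small in the sense of Lemma 9.4,
`∫_{B(2R√(−t'))} ‖ω(t')‖² ≤ θ²/(4√(−t'))`.  (Tao 2021 Prop. 4.3 — tree `TaoCarleman.second_carleman_inequality_of_ball` —
applied ONCE to `w(s, x) = ω(t̄ − s(−t̄), √(−t̄)y₀ + √(−t̄)x)`-type rescaled, time-reversed vorticity on a cylinder of height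
`T_c(C_u, K) (−t̄)` below `t̄`, radius `≍ (|y₀| + R)√(−t̄)`, with `|∂ₛw + Δw| ≤ T_c⁻¹|w| + T_c^{-1/2}|∇w|` from the Type-I
coefficient bounds; Gaussian-weight loss `exp(O((|y₀|+R)²/T_c))`; Chebyshev in time picks `t'`.) -/
def PeepholeToCore : Prop :=
  ∀ Cu : ℝ, 0 < Cu → ∀ θ : ℝ, 0 < θ → ∀ R : ℝ, 2 ≤ R → ∀ (K K₂ : ℝ), 0 < K → 0 < K₂ →
    ∀ (y₀ : EuclideanSpace ℝ (Fin 3)) (r : ℝ), 0 < r →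
    ∃ ε : ℝ, 0 < ε ∧ ∃ τ : ℝ, 0 < τ ∧ ∀ c₁ : ℝ, 0 < c₁ → ∃ T₁ : ℝ, 0 < T₁ ∧ T₁ ≤ 1 ∧
    ∀ (u : ℝ → EuclideanSpace ℝ (Fin 3) → EuclideanSpace ℝ (Fin 3)) (p : ℝ → EuclideanSpace ℝ (Fin 3) → ℝ),
      IsClassicalNSSolutionOnRegion
        (Ico (-1 : ℝ) 0 ×ˢ ball (0 : EuclideanSpace ℝ (Fin 3)) 1) 1 0 u p →
      (∀ t ∈ Ico (-1 : ℝ) 0, ∀ x ∈ ball (0 : EuclideanSpace ℝ (Fin 3)) 1,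
        ‖u t x‖ ≤ Cu / (Real.sqrt (-t) + ‖x‖)) →
      (∀ t ∈ Ioo (-1 : ℝ) 0, ∀ x : EuclideanSpace ℝ (Fin 3), ‖x‖ + Real.sqrt (-t) ≤ c₁ →
        ‖fderiv ℝ (u t) x‖ ≤ K / (‖x‖ + Real.sqrt (-t)) ^ 2) →
      (∀ t ∈ Ioo (-1 : ℝ) 0, ∀ x : EuclideanSpace ℝ (Fin 3), ‖x‖ + Real.sqrt (-t) ≤ c₁ →
        ‖iteratedFDeriv ℝ 2 (u t) x‖ ≤ K₂ / (‖x‖ + Real.sqrt (-t)) ^ 3) →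
      ∀ tb ∈ Ioo (-T₁) 0,
        (∀ x ∈ ball (Real.sqrt (-tb) • y₀) (Real.sqrt (-tb) * r), (-tb) * ‖curl (u tb) x‖ ≤ ε) →
        ∃ t' ∈ Icc ((1 + 2 * τ) * tb) ((1 + τ) * tb),
          ∫⁻ x in ball (0 : EuclideanSpace ℝ (Fin 3)) (2 * R * Real.sqrt (-t')),
              ENNReal.ofReal (‖curl (u t') x‖ ^ 2) ≤
            ENNReal.ofReal (θ ^ 2 / (4 * Real.sqrt (-t')))


/-! ## §2b The transfer lemma with EXPLICIT constants (DIRECTOR-NS #100 (1)(a): «ε as a formula in ν, M, r, |y₀|»)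

Scaling count (cheapest falsifier, run 2026-08-28): at the slice `t̄` put `ℓ = √(−t̄)` and `ũ(s,y) = ℓ u(t̄ + ℓ²s, ℓy)`; the apex
is at `s = +1`, the unique-continuation cylinder is `s ∈ [−T_c, 0]`, where Type I gives the SCALE-INVARIANT coefficient
bounds `|ũ| ≤ C_u`, `|∇ũ| ≤ K`, `|∇²ũ| ≤ K₂`; the time-reversed normalised vorticity `w(σ,y) = ℓ²ω(t̄ − ℓ²σ, ℓy)` satisfies
`|∂_σ w + Δw| ≤ K|w| + C_u|∇w| ≤ T_c⁻¹|w| + T_c^{-1/2}|∇w|`, `T_c = min(1, 1/K, 1/C_u²)` — Tao's (4.4).  One application of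
Prop. 4.3 centred at `y₀`, radius `r_T ≍ D := |y₀| + 2R + 1`, `t₀ = T_c/8000`: Gaussian loss `e^{2000 D²/T_c}`, tail error
`e^{−r_T²/(500t₀)}·O(r_T³(K²+K₂²))`, data cost `e^{K_abs (r_T²/t₀) log(e t₀/t₁)}` against the outside-peephole leak
`t₁^{-3/2} e^{−r²/(4t₁)}` (power beats log).  Net: `ε = θ·exp(−A·Λ)` with
`Λ = (D²/T_c + log(2 + (K²+K₂²)D³/θ²))·(1 + log(1 + D²/r²))`, ONE absolute constant `A` (absorbing Tao's `K_abs`, `8000`,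
`500` and the dimension) — single exponential, no tower.  The lag is `τ = T_c/8000` (Tao's window `σ ∈ [t₀, 2t₀]`), the
lateness `T₁ = min(1, (c₁/(A·D))²)` (the cylinder of radius `≍ A·D·ℓ` must sit inside the gradient-bound region `|x|+√(−t) ≤ c₁`). -/

/-- `D = |y₀| + 2R + 1`: similarity distance from the apex axis to the far side of the transfer geometry. -/
def dS29 (R d : ℝ) : ℝ := d + 2 * R + 1

/-- `T_c = min(1, 1/K, 1/C_u²)`: the height fraction making Tao's normalisation (4.4) hold for the vorticity equation. -/
def tcS29 (Cu K : ℝ) : ℝ := min 1 (min (1 / K) (1 / Cu ^ 2))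

/-- the exponent budget `Λ = (D²/T_c + log(2 + (K²+K₂²)D³/θ²))·(1 + log(1 + D²/r²))`. -/
def lamS29 (Cu K K₂ θ R d r : ℝ) : ℝ :=
  ((dS29 R d) ^ 2 / tcS29 Cu K + Real.log (2 + (K ^ 2 + K₂ ^ 2) * (dS29 R d) ^ 3 / θ ^ 2)) *
    (1 + Real.log (1 + (dS29 R d) ^ 2 / r ^ 2))

/-- **the explicit threshold** `ε(A; C_u, K, K₂, θ, R, |y₀|, r) = θ · exp(−A·Λ)`. -/
def epsS29 (A Cu K K₂ θ R d r : ℝ) : ℝ := θ * Real.exp (-(A * lamS29 Cu K K₂ θ R d r))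

/-- the lag `τ = T_c/8000`. -/
def tauS29 (Cu K : ℝ) : ℝ := tcS29 Cu K / 8000

/-- the lateness `T₁ = min(1, (c₁/(A D))²)`. -/
def t1S29 (A R d c₁ : ℝ) : ℝ := min 1 ((c₁ / (A * dS29 R d)) ^ 2)

/-- **hB′ with explicit constants — THE crux of S29 as ONE transfer lemma.**  There is ONE absolute constant `A > 0` such
that for all data the peephole-to-core transfer `PeepholeToCore` holds with `ε := epsS29 A …`, `τ := tauS29 …`,
`T₁ := t1S29 A …` — every dependence on `(C_u, K, K₂, θ, R, |y₀|, r, c₁)` (hence on `ν, M, U` in the door frame) is a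
formula; only `A` (Tao's absolute Carleman constant and numerics) is existential. -/
def PeepholeToCoreExplicit : Prop :=
  ∃ A : ℝ, 0 < A ∧
  ∀ Cu : ℝ, 0 < Cu → ∀ θ : ℝ, 0 < θ → ∀ R : ℝ, 2 ≤ R → ∀ (K K₂ : ℝ), 0 < K → 0 < K₂ →
    ∀ (y₀ : EuclideanSpace ℝ (Fin 3)) (r : ℝ), 0 < r → ∀ c₁ : ℝ, 0 < c₁ →
    ∀ (u : ℝ → EuclideanSpace ℝ (Fin 3) → EuclideanSpace ℝ (Fin 3)) (p : ℝ → EuclideanSpace ℝ (Fin 3) → ℝ),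
      IsClassicalNSSolutionOnRegion
        (Ico (-1 : ℝ) 0 ×ˢ ball (0 : EuclideanSpace ℝ (Fin 3)) 1) 1 0 u p →
      (∀ t ∈ Ico (-1 : ℝ) 0, ∀ x ∈ ball (0 : EuclideanSpace ℝ (Fin 3)) 1,
        ‖u t x‖ ≤ Cu / (Real.sqrt (-t) + ‖x‖)) →
      (∀ t ∈ Ioo (-1 : ℝ) 0, ∀ x : EuclideanSpace ℝ (Fin 3), ‖x‖ + Real.sqrt (-t) ≤ c₁ →
        ‖fderiv ℝ (u t) x‖ ≤ K / (‖x‖ + Real.sqrt (-t)) ^ 2) →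
      (∀ t ∈ Ioo (-1 : ℝ) 0, ∀ x : EuclideanSpace ℝ (Fin 3), ‖x‖ + Real.sqrt (-t) ≤ c₁ →
        ‖iteratedFDeriv ℝ 2 (u t) x‖ ≤ K₂ / (‖x‖ + Real.sqrt (-t)) ^ 3) →
      ∀ tb ∈ Ioo (-(t1S29 A R ‖y₀‖ c₁)) 0,
        (∀ x ∈ ball (Real.sqrt (-tb) • y₀) (Real.sqrt (-tb) * r),
            (-tb) * ‖curl (u tb) x‖ ≤ epsS29 A Cu K K₂ θ R ‖y₀‖ r) →
        ∃ t' ∈ Icc ((1 + 2 * tauS29 Cu K) * tb) ((1 + tauS29 Cu K) * tb),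
          ∫⁻ x in ball (0 : EuclideanSpace ℝ (Fin 3)) (2 * R * Real.sqrt (-t')),
              ENNReal.ofReal (‖curl (u t') x‖ ^ 2) ≤
            ENNReal.ofReal (θ ^ 2 / (4 * Real.sqrt (-t')))

/-- explicit ⇒ existential form. -/
theorem peepholeToCore_of_explicit (h : PeepholeToCoreExplicit) : PeepholeToCore := by
  obtain ⟨A, hA, h⟩ := h
  intro Cu hCu θ hθ R hR K K₂ hK hK₂ y₀ r hr
  have hD : 0 < dS29 R ‖y₀‖ := by
    have := norm_nonneg y₀
    unfold dS29; linarith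
  have hTc : 0 < tcS29 Cu K := by
    unfold tcS29
    exact lt_min one_pos (lt_min (by positivity) (by positivity))
  refine ⟨epsS29 A Cu K K₂ θ R ‖y₀‖ r, mul_pos hθ (Real.exp_pos _), tauS29 Cu K, div_pos hTc (by norm_num),
    fun c₁ hc₁ => ⟨t1S29 A R ‖y₀‖ c₁, ?_, min_le_left _ _, ?_⟩⟩
  · exact lt_min one_pos (by positivity)
  · intro u p hsol hTI hg1 hg2 tb htb hpeep
    exact h Cu hCu θ hθ R hR K K₂ hK hK₂ y₀ r hr c₁ hc₁ u p hsol hTI hg1 hg2 tb htb hpeep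

/-- **door S29 in the Pineau–Vicol frame** (Theorem 1.9 with the residual hypothesis (1.17) replaced by peephole-small
vorticity): for `C_u` and the peephole `(y₀, r)` an `ε ∈ (0,1]`, for `C_p` a lateness `s₀ ≥ 1`, such that (1.15) + (1.16) +
`(−t̄)‖ω(t̄)‖ ≤ ε` on `B(√(−t̄)y₀, √(−t̄)r)` at ONE `t̄ ∈ (−e^{−s₀}, 0)` ⇒ `(0,0)` regular (bounded on some `B_ϱ × (−ϱ², 0)`). -/
def PVPeepholeRegularity : Prop :=
  ∀ Cu : ℝ, 0 < Cu → ∀ (y₀ : EuclideanSpace ℝ (Fin 3)) (r : ℝ), 0 < r → ∃ ε : ℝ, 0 < ε ∧ ε ≤ 1 ∧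
    ∀ Cp : ℝ, 0 < Cp → ∃ s₀ : ℝ, 1 ≤ s₀ ∧
    ∀ (u : ℝ → EuclideanSpace ℝ (Fin 3) → EuclideanSpace ℝ (Fin 3)) (p : ℝ → EuclideanSpace ℝ (Fin 3) → ℝ),
      IsClassicalNSSolutionOnRegion
        (Ico (-1 : ℝ) 0 ×ˢ ball (0 : EuclideanSpace ℝ (Fin 3)) 1) 1 0 u p →
      (∀ t ∈ Ico (-1 : ℝ) 0, ∀ x ∈ ball (0 : EuclideanSpace ℝ (Fin 3)) 1,
        ‖u t x‖ ≤ Cu / (Real.sqrt (-t) + ‖x‖)) →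
      (∀ t ∈ Ico (-1 : ℝ) 0, ∀ x : EuclideanSpace ℝ (Fin 3), 1 / 2 < ‖x‖ → ‖x‖ < 3 / 4 → |p t x| ≤ Cp) →
      ∀ tbar : ℝ, -Real.exp (-s₀) < tbar → tbar < 0 →
        (∀ x ∈ ball (Real.sqrt (-tbar) • y₀) (Real.sqrt (-tbar) * r), (-tbar) * ‖curl (u tbar) x‖ ≤ ε) →
        ∃ ϱ : ℝ, 0 < ϱ ∧ ∃ B : ℝ, ∀ t : ℝ, -ϱ ^ 2 < t → t < 0 →
          ∀ x ∈ ball (0 : EuclideanSpace ℝ (Fin 3)) ϱ, ‖u t x‖ ≤ B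

/-! ## §3 The composition (the three registered stubs of the LINE DOC enter as HYPOTHESES; FILES 2–4 discharge them) -/

/-- **COMPOSITION: door S29 from the three inputs of the line** — the explicit transfer `PeepholeToCoreExplicit` (FILE 2,
Tao 2021 Prop. 4.3), the Pineau–Vicol assembly `PeepholeToCore → PVPeepholeRegularity` (FILE 3) and the frame transfer
`PVPeepholeRegularity → TargetPeepholeVorticity` (FILE 4). -/
theorem targetPeepholeVorticity_of (h₁ : PeepholeToCoreExplicit) (h₂ : PeepholeToCore → PVPeepholeRegularity)
    (h₃ : PVPeepholeRegularity → TargetPeepholeVorticity) : TargetPeepholeVorticity :=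
  h₃ (h₂ (peepholeToCore_of_explicit h₁))

/-! ## §4 Sanity: the door at `(ν, M, U)` implies the SEQUENTIAL peephole-vorticity door of the S26 family (same `ε`),
so S29 is at least as strong as the (trivial-residue) compactness instance «T-irrot-seq» — and it is EFFECTIVE. -/

/-- the sequential form implied by S29 (solution-dependent lateness is free: `E₀ :=` the solution's own energy). -/
theorem seq_of_target {ν M : ℝ} {U : Set (EuclideanSpace ℝ (Fin 3))} (h : TargetPeepholeVorticityAt ν M U) :
    ∃ ε : ℝ, 0 < ε ∧ ∀ (T : ℝ), 0 < T →
    ∀ (u : ℝ → EuclideanSpace ℝ (Fin 3) → EuclideanSpace ℝ (Fin 3)) (p : ℝ → EuclideanSpace ℝ (Fin 3) → ℝ),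
    IsClassicalNSSolutionOn (Set.Ico 0 T) ν 0 u p → IsLerayHopfOn T ν 0 (u 0) u → HasRapidSpatialDecay (u 0) →
    ∀ (x₀ : EuclideanSpace ℝ (Fin 3)) (ρ : ℝ), 0 < ρ →
    (∀ t ∈ Set.Ico 0 T, T - ρ ^ 2 < t → ∀ x ∈ Metric.ball x₀ ρ, ‖u t x‖ * (‖x - x₀‖ + Real.sqrt (ν * (T - t))) ≤ M) →
    ∀ (t : ℕ → ℝ), (∀ n, t n < T) → Tendsto t atTop (𝓝 T) →
    (∀ n, ∀ y ∈ U, ‖curl (physWindowField T x₀ u (t n)) y‖ ≤ ε) → IsBackwardBoundedAt u T x₀ := by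
  obtain ⟨ε, hε, h⟩ := h
  refine ⟨ε, hε, fun T hT u p hcl hLH hdec x₀ ρ hρ hM t htT ht hgood => ?_⟩
  obtain ⟨tstar, htstar, hts⟩ := h T ρ (VectorCalculus.kineticEnergy (u 0)) hT hρ
  obtain ⟨n, hn⟩ := (ht.eventually (lt_mem_nhds htstar)).exists
  exact hts u p hcl hLH hdec le_rfl x₀ hM (t n) ⟨hn, htT n⟩ (hgood n)

/-! ## §5 (appended by nsreg-p6 g15) The Pineau–Vicol-frame door with INTEGRAL pressure hypotheses — the form the
frame transfer (FILE 4) delivers from the Leray–Hopf door frame -/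

/-- **door S29 in the Pineau–Vicol frame, INTEGRAL pressure form** (variant of `PVPeepholeRegularity`).  The annular sup
bound (1.16) `|p| ≤ C_p` on `{1/2 < |x| < 3/4}` is replaced by what the printed proof of Theorem 1.9 actually consumes
downstream of (1.16): a bound `B_p` for `∫∫_{(−1,0)×B₁} |p|^{3/2}` (Lemma 9.2 / Cor. 9.3 through
`exists_forall_fderiv_le_of_typeI_of_bounds`, `exists_forall_iteratedFDeriv_le_of_typeI_of_bounds 2`, and the class
`p ∈ L^{3/2}` of Prop. 9.5 `pineauVicol_regular_of_zoom`), together with the finiteness of the local dissipation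
`∫∫_{(−1,0)×B₁} |∇u|² < ∞` (the class `∇u ∈ L²` of Prop. 9.5).  In the Leray–Hopf door frame both come CLASS-UNIFORMLY and
for free from the energy inequality and the Calderón–Zygmund bound of the gauged pressure
(`StableStrataDoorClassSlabLevels.lintegral_slab_gauged_pressure_le`, `…lintegral_slab_frobeniusNormSq_fderiv_le`), whereas
a class-uniform SUP bound (1.16) would need interior gradient estimates on the Type-I annulus.  The lateness `s₀` may depend
on `B_p` exactly as it depends on `C_p` in (1.16). -/
def PVPeepholeRegularityInt : Prop :=
  ∀ Cu : ℝ, 0 < Cu → ∀ (y₀ : EuclideanSpace ℝ (Fin 3)) (r : ℝ), 0 < r → ∃ ε : ℝ, 0 < ε ∧ ε ≤ 1 ∧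
    ∀ Bp : ℝ≥0, ∃ s₀ : ℝ, 1 ≤ s₀ ∧
    ∀ (u : ℝ → EuclideanSpace ℝ (Fin 3) → EuclideanSpace ℝ (Fin 3)) (p : ℝ → EuclideanSpace ℝ (Fin 3) → ℝ),
      IsClassicalNSSolutionOnRegion
        (Ico (-1 : ℝ) 0 ×ˢ ball (0 : EuclideanSpace ℝ (Fin 3)) 1) 1 0 u p →
      (∀ t ∈ Ico (-1 : ℝ) 0, ∀ x ∈ ball (0 : EuclideanSpace ℝ (Fin 3)) 1,
        ‖u t x‖ ≤ Cu / (Real.sqrt (-t) + ‖x‖)) →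
      (∫⁻ w in Ioo (-1 : ℝ) 0 ×ˢ ball (0 : EuclideanSpace ℝ (Fin 3)) 1, ‖p w.1 w.2‖ₑ ^ (3 / 2 : ℝ) ≤ Bp) →
      (∫⁻ w in Ioo (-1 : ℝ) 0 ×ˢ ball (0 : EuclideanSpace ℝ (Fin 3)) 1,
          ENNReal.ofReal (frobeniusNormSq (fderiv ℝ (u w.1) w.2)) < ⊤) →
      ∀ tbar : ℝ, -Real.exp (-s₀) < tbar → tbar < 0 →
        (∀ x ∈ ball (Real.sqrt (-tbar) • y₀) (Real.sqrt (-tbar) * r), (-tbar) * ‖curl (u tbar) x‖ ≤ ε) →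
        ∃ ϱ : ℝ, 0 < ϱ ∧ ∃ B : ℝ, ∀ t : ℝ, -ϱ ^ 2 < t → t < 0 →
          ∀ x ∈ ball (0 : EuclideanSpace ℝ (Fin 3)) ϱ, ‖u t x‖ ≤ B

/-- **COMPOSITION through the integral form:** door S29 from hB′, an assembly into the integral PV-frame door, and a
frame transfer out of it. -/
theorem targetPeepholeVorticity_of_int (h₁ : PeepholeToCoreExplicit) (h₂ : PeepholeToCore → PVPeepholeRegularityInt)
    (h₃ : PVPeepholeRegularityInt → TargetPeepholeVorticity) : TargetPeepholeVorticity :=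
  h₃ (h₂ (peepholeToCore_of_explicit h₁))

end Summit.NavierStokesRegularity.NavierStokesRegularity.Theorems.PeepholeVorticityDoor

end
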